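import Mathlib
import HarnessLib
import Literature.NumberTheory.DiophantineGeometry.BelyiDegree

/-!
# Three-point fibres of a rational map are extremal exactly for Belyi maps: the counting half

For coprime `p q : k[X]` over an algebraically closed field `k` of characteristic `0`, with
`d = max (deg p) (deg q) ≥ 1`, the rational map `β = p/q : ℙ¹ → ℙ¹` has degree `d` and its fibre over
`{0, 1, ∞}` consists of the distinct zeros of `p · q · (p − q)` together with (possibly) `∞`.
Riemann–Hurwitz gives `#β⁻¹{0,1,∞} ≥ d + 2`, with equality iff `β` is unramified outside `{0,1,∞}`
(a Belyi map).  This file proves the *affine counting half* of this statement from Mathlib's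
Mason–Stothers theorem (`Polynomial.abc`):

* `natDegree_radical_eq_card_roots` — over an algebraically closed field, `deg rad f` is the number
  of distinct zeros of `f` (the dictionary between `Polynomial.abc` and root counts);
* `succ_max_natDegree_le_card_roots` — for coprime `p, q` with `max (deg p) (deg q) = d ≥ 1` in
  characteristic `0`, `p · q · (p − q)` has at least `d + 1` distinct zeros (add the point `∞` when
  one of `deg p, deg q, deg (p − q)` drops below `d` to get `#β⁻¹{0,1,∞} ≥ d + 2`).

Consequently the clause `(p * q * (p - q)).roots.toFinset.card = d + 1` in
`Literature.NumberTheory.DiophantineGeometry.HasBelyiWitness` (file `BelyiDegree.lean`, the inlined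
witness `W(d,t)` of route `Summit.ABC.ABC.Theses.BelyiDegreeSmooth`) is the *equality case* of
Mason–Stothers / Riemann–Hurwitz [folklore; Goldring 2011, "Unifying themes suggested by Belyi's
theorem", Thm 3.2: "Belyi = equality in Mason–Stothers"]: `HasBelyiWitness.succ_le_card` and
`hasBelyiWitness_iff_card_le` (the clause `= d + 1` may be replaced by `≤ d + 1`).  The converse
direction (equality iff every critical value of `p/q` lies in `{0,1,∞}`) is not formalised here.
-/

namespace Literature.NumberTheory.DiophantineGeometry

open Polynomial UniqueFactorizationMonoid

section Radical

variable {k : Type*} [Field k] [IsAlgClosed k] [DecidableEq k]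

/-- Over an algebraically closed field the radical of a non-zero polynomial is the product of
`X - a` over its distinct zeros `a` [folklore]. -/
theorem radical_eq_prod_roots {f : k[X]} (hf : f ≠ 0) :
    radical f = ∏ a ∈ f.roots.toFinset, (X - C a) := by
  have hsplit : C f.leadingCoeff * (f.roots.map fun a => X - C a).prod = f :=
    C_leadingCoeff_mul_prod_multiset_X_sub_C IsAlgClosed.card_roots_eq_natDegree
  have hlc : IsUnit (C f.leadingCoeff) := isUnit_C.mpr (leadingCoeff_ne_zero.mpr hf).isUnit
  have hrel : Set.Pairwise (f.roots.toFinset : Set k)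
      (Function.onFun IsRelPrime fun a => (X - C a) ^ f.roots.count a) := fun a _ b _ hab =>
    ((pairwise_coprime_X_sub_C (s := id) Function.injective_id hab).pow).isRelPrime
  calc radical f = radical (C f.leadingCoeff * (f.roots.map fun a => X - C a).prod) := by
          rw [hsplit]
    _ = radical ((f.roots.map fun a => X - C a).prod) := radical_mul_of_isUnit_left hlc
    _ = ∏ a ∈ f.roots.toFinset, radical ((X - C a) ^ f.roots.count a) := by
          rw [Finset.prod_multiset_map_count, radical_prod _ hrel]
    _ = ∏ a ∈ f.roots.toFinset, (X - C a) := by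
          refine Finset.prod_congr rfl fun a ha => ?_
          rw [radical_pow _ (Multiset.count_ne_zero.mpr (Multiset.mem_toFinset.mp ha)),
            radical_of_prime (prime_X_sub_C a), (monic_X_sub_C a).normalize_eq_self]

/-- Over an algebraically closed field, `deg (rad f)` is the number of distinct zeros of `f`
(for `f = 0` both sides are `0` by Mathlib's conventions) [folklore]. -/
theorem natDegree_radical_eq_card_roots (f : k[X]) :
    (radical f).natDegree = f.roots.toFinset.card := by
  by_cases hf : f = 0
  · subst hf
    simp
  · rw [radical_eq_prod_roots hf, natDegree_finsetProd_X_sub_C_eq_card]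

end Radical

section Count

variable {k : Type*} [Field k] [IsAlgClosed k] [CharZero k] [DecidableEq k]

/-- **Counting half of "Belyi = equality in Mason–Stothers".**  For coprime `p, q ∈ k[X]`
(`k` algebraically closed of characteristic `0`) with `max (deg p) (deg q) = d ≥ 1`, the polynomial
`p · q · (p − q)` has at least `d + 1` distinct zeros; i.e. the rational map `p/q` of degree `d` has at
least `d + 1` affine points over `{0, 1, ∞}`.  Proof: Mason–Stothers (`Polynomial.abc`) for
`q + (p − q) + (−p) = 0`, and `deg rad = #`distinct zeros (`natDegree_radical_eq_card_roots`)
[folklore]. -/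
theorem succ_max_natDegree_le_card_roots {p q : k[X]} (hcop : IsCoprime p q) {d : ℕ}
    (hmax : max p.natDegree q.natDegree = d) (hd : 0 < d) :
    d + 1 ≤ (p * q * (p - q)).roots.toFinset.card := by
  -- non-vanishing: a unit has degree `0`, so none of `p, q, p - q` is `0`
  have hunit : ∀ {u : k[X]}, IsUnit u → u.natDegree = 0 := fun hu => natDegree_eq_zero_of_isUnit hu
  have hp0 : p ≠ 0 := by
    rintro rfl
    have h1 := hunit (isCoprime_zero_left.mp hcop)
    rw [natDegree_zero, h1, max_self] at hmax
    omega
  have hq0 : q ≠ 0 := by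
    rintro rfl
    have h1 := hunit (isCoprime_zero_right.mp hcop)
    rw [natDegree_zero, h1, max_self] at hmax
    omega
  have hpq0 : p - q ≠ 0 := by
    intro h
    have hpq : p = q := sub_eq_zero.mp h
    rw [hpq] at hcop hmax
    have := hunit (isCoprime_self.mp hcop)
    rw [max_self] at hmax
    omega
  -- Mason–Stothers for `q + (p - q) + (-p) = 0`
  have hcop' : IsCoprime q (p - q) := by
    have : IsCoprime q (p - q + q * 1) := by simpa using hcop.symm
    exact (IsCoprime.add_mul_left_right_iff).mp this
  have hsum : q + (p - q) + -p = 0 := by ring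
  rcases Polynomial.abc hq0 hpq0 (neg_ne_zero.mpr hp0) hcop' hsum with ⟨hq, -, hp⟩ | ⟨hq', -, hp'⟩
  · -- the radical of `q (p - q) (-p)` has as many distinct zeros as `p q (p - q)`
    have hroots : (q * (p - q) * -p).roots.toFinset = (p * q * (p - q)).roots.toFinset := by
      have : q * (p - q) * -p = -(p * q * (p - q)) := by ring
      rw [this, roots_neg]
    rw [natDegree_radical_eq_card_roots, hroots, natDegree_neg] at hp
    rw [natDegree_radical_eq_card_roots, hroots] at hq
    rcases max_choice p.natDegree q.natDegree with h | h <;> omega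
  · -- characteristic `0`: vanishing derivatives force constants, contradicting `d ≥ 1`
    have hp'' : p.natDegree = 0 := by
      rw [derivative_neg, neg_eq_zero] at hp'
      exact Polynomial.derivative_eq_zero.mp hp'
    have hq'' : q.natDegree = 0 := Polynomial.derivative_eq_zero.mp hq'
    rw [hp'', hq'', max_self] at hmax
    omega

end Count

/-! ### Belyi witnesses are the extremal pairs -/

/-- For every pair `(p, q)` admissible in `HasBelyiWitness d t` except for the root count, the count is
at least `d + 1`; in particular a Belyi witness realises the minimum [folklore]. -/
theorem HasBelyiWitness.succ_le_card {p q : ℂ[X]} {d : ℕ} (hcop : IsCoprime p q)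
    (hmax : max p.natDegree q.natDegree = d)
    (hdrop : p.natDegree < d ∨ q.natDegree < d ∨ (p - q).natDegree < d) :
    d + 1 ≤ (p * q * (p - q)).roots.toFinset.card := by
  have hd : 0 < d := by rcases hdrop with h | h | h <;> exact Nat.lt_of_le_of_lt (Nat.zero_le _) h
  exact succ_max_natDegree_le_card_roots hcop hmax hd

/-- `HasBelyiWitness d t` with the root-count clause relaxed from `= d + 1` to `≤ d + 1`: the two are
equivalent by Mason–Stothers (`HasBelyiWitness.succ_le_card`), i.e. Belyi witnesses are exactly the
coprime pairs of degree `d` (with `∞, 0, 1, t` special) minimising the number of distinct zeros of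
`p · q · (p − q)` [folklore]. -/
theorem hasBelyiWitness_iff_card_le (d : ℕ) (t : ℂ) :
    HasBelyiWitness d t ↔
      ∃ p q : Polynomial ℂ, IsCoprime p q ∧ max p.natDegree q.natDegree = d ∧
        (p.natDegree < d ∨ q.natDegree < d ∨ (p - q).natDegree < d) ∧
        (p * q * (p - q)).roots.toFinset.card ≤ d + 1 ∧
        (p * q * (p - q)).eval 0 = 0 ∧ (p * q * (p - q)).eval 1 = 0 ∧
        (p * q * (p - q)).eval t = 0 := by
  constructor
  · rintro ⟨p, q, hcop, hmax, hdrop, hcard, h0, h1, ht⟩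
    exact ⟨p, q, hcop, hmax, hdrop, hcard.le, h0, h1, ht⟩
  · rintro ⟨p, q, hcop, hmax, hdrop, hcard, h0, h1, ht⟩
    exact ⟨p, q, hcop, hmax, hdrop,
      le_antisymm hcard (HasBelyiWitness.succ_le_card hcop hmax hdrop), h0, h1, ht⟩

end Literature.NumberTheory.DiophantineGeometry
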